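import Summits.BirchSwinnertonDyer.BirchSwinnertonDyer.Theorems.PrintCFramBottomClassIndexLawFiveLeKrizLiBindersTwist
import Summits.BirchSwinnertonDyer.BirchSwinnertonDyer.Theorems.PrintCFramBottomClassIndexLawFiveLeEisensteinTraceFormClass
import Literature.NumberTheory.EllipticCurves.ComplexMultiplicationLFunctionTableProofs
import Literature.NumberTheory.EllipticCurves.ComplexMultiplicationHasCMIffProofs
import Literature.NumberTheory.EllipticCurves.IsogenyIdProofs
import HarnessLib

/-!
# Crux `PrintCFram.BottomClassIndexLawFiveLe` (stmt-BirchSwinnertonDyer-20372), line `eisenstein-resource-bdp-line`: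
# the KRIZ–LI BINDERS CLASS-LEVEL, part W — ON THE CRUX'S OWN BINDERS (`W.HasCM`, `CMRamified W p`, `5 ≤ p`) the character
# data of Kriz–Li Thm. 1.20 EXIST: a primitive ODD `ψ = χ_D·ω^k` with `hss`, (1), (3) — for every Teichmüller `ω`
# (cell `bsd-print-cfram`, width seat `bsd-line-cfram-p1-w3` g2; THEOREMS ONLY, `--supports` 20372; BSD is not proved by any of this)

HONEST FRAMING. Nothing here is a statement about BSD; no stub of the skeleton is closed. What is proved: the «(regular) Kriz–Li
datum» hypothesis of the line's v6 skeleton (`Cruxes/BottomClassIndexLawFiveLe/Lines/eisenstein_resource_bdp_line.lean`) and of the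
LEAD's Kriz–Li-locus theorems (`…RegularLocusBSDp`, `…KrizLiLocusKolyvagin`) quantifies over `(f, ψ, ω)` with FIVE conjuncts of
CHARACTER DATA — `ψ.IsPrimitive`, `IsTeichmullerCharacter ω`, `hss`, KL (1), KL (3) — next to the Heegner field `K''`, `ε_K`,
the Bernoulli hypothesis (4) and the frame. THIS FILE DISCHARGES THE FIVE, CLASS-WIDE: for every elliptic `W/ℚ` with CM,
every `p ≥ 5` ramified in the CM field, and EVERY Teichmüller `ω` mod `p`, there is a primitive `ψ` (of level `p·m`,
`ψ = χ·ω^k` with `χ` the `ℚ_p`-valued Kronecker character of the member's `p`-coprime twisting discriminant, `k ∈ {(p+1)/4,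
(3p−1)/4}` chosen to make `ψ` ODD) satisfying `hss`, (1), (3) verbatim (`krizLiBinders_of_cmRamified`); with
`KrizLi2019.exists_isTeichmullerCharacter` also `ω` exists (`exists_krizLiBinders_of_cmRamified`). So a Kriz–Li datum on the
class is: a Heegner field `K''` (odd `d_K < −4`, `L(W^{(d_K)},1) ≠ 0`), `ε_K`, and (4) — for the odd `ψ`, w2 g4's
`…RegularLocusBernoulliPairOdd` reads (4) as `p ∤ B_{1,ψ⁻¹}·B_{1,ψε_Kω⁻¹}` — [+ regularity on the regular locus].

Assembly: `AnchorReduction.classes_of_cmRamified` (the seven `(p, j)` classes), the six base curves `A(p)` (`cm7`, `cm11`, `cm19`,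
`cm43`, `cm67`, `cm163`: good away from `p`, Eisenstein trace forms `a_ℓ ≡ ℓ^{(p+1)/4} + ℓ^{(3p−1)/4}` — w2 g2 / Route U / p611699),
`exists_isIsogenous_LFunction_eq_cm28` (the class `j = 16581375` is `ℚ`-isogenous to `j = −3375`), LEAD g0's
`exists_coprime_twist_isIsogenous` (twisting parameter coprime to `p`, up to isogeny), part T's twist layer and engine, part Ψ's
parity lemmas. beyond-print theorem: NO.

References: [KrizLi2019] Thm. 1.20, Rem. 1.21 (CM by `ℚ(√−p)`), §1.5, §2, §7.1 (symmetry `ψ ↔ ψ⁻¹ω`); [Mazur1978] Prop. 6.3 (1);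
[BuhlerGross1985] Ch. I (4.3); [SilvermanAEC2009] X.5 Prop. 5.4; [Cox2013] §1.C Lemma 1.14; [Washington1997] §5.1.
-/

noncomputable section

-- summit-side namespace `Summit.BirchSwinnertonDyer.BirchSwinnertonDyer.…` (single-conjunct summit, D-0017 layout)
set_option linter.dupNamespace false

open scoped Classical NumberTheorySymbols
open NumberField WeierstrassCurve DirichletCharacter
open Literature.NumberTheory.EllipticCurves Literature.NumberTheory.EllipticCurves.KrizLi2019
open Literature.NumberTheory.EllipticCurves.Rank1Residual
open Summit.BirchSwinnertonDyer.Rank1Residual Summit.BirchSwinnertonDyer.Rank1Residual.X12.O11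

namespace Summit.BirchSwinnertonDyer.BirchSwinnertonDyer.Theorems.PrintCFram.KrizLiBinders

variable {p : ℕ} [hp : Fact p.Prime]

/-! ## §1 From a base curve of the class to the character data, with the ODD exponent chosen -/

/-- **Character data from a base curve.** Let `p ≡ 3 (mod 4)`, `p ≥ 5`, and `E/ℚ` a CM curve with `p` CM-ramified, good
reduction away from `p` and Eisenstein trace form `a_ℓ(E) ≡ ℓ^{(p+1)/4} + ℓ^{(3p−1)/4} (mod p)` at every prime `ℓ ≠ p`. Then
every elliptic `W` that is `ℚ`-isogenous to a curve with `j = j(E)` carries the character data of part T's engine with an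
exponent `k ∈ {(p+1)/4, (3p−1)/4}`, `2 ≤ k ≤ p − 2`, for which `χ(−1)·(−1)^k = −1` (so `ψ = χ·ω^k` is odd).
[cite: KrizLi2019, Thm. 1.20, Rem. 1.21 and §7.1 (p. 43, ψ ↔ ψ⁻¹ω)] [cite: SilvermanAEC2009, X.5 Prop. 5.4 and Cor. 5.4.1] -/
theorem exists_krizLiData_of_base (hp4 : p % 4 = 3) (h5 : 5 ≤ p) (E : WeierstrassCurve ℚ) [E.IsElliptic]
    (hCME : E.HasCM) (hramE : CMRamified E p)
    (hgood : ∀ (q : ℕ) [Fact q.Prime], q ≠ p → E.HasGoodReductionAtPrime q)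
    (hbase : ∀ (ℓ : ℕ) [Fact ℓ.Prime], ℓ ≠ p →
      (E.LFunction ℓ : ZMod p) = (ℓ : ZMod p) ^ ((p + 1) / 4) + (ℓ : ZMod p) ^ ((3 * p - 1) / 4))
    (W : WeierstrassCurve ℚ) [W.IsElliptic]
    (hW : ∃ (W' : WeierstrassCurve ℚ) (_ : W'.IsElliptic), IsIsogenous W W' ∧ W'.j = E.j) :
    ∃ (m : ℕ) (_ : NeZero m) (χ : DirichletCharacter ℚ_[p] m) (ε : ℕ → ℤ) (k : ℕ),
      m.Coprime p ∧ χ.IsPrimitive ∧ χ.IsQuadratic ∧ (∀ a : ℕ, χ (a : ZMod m) = (ε a : ℚ_[p])) ∧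
      (k = (p + 1) / 4 ∨ k = (3 * p - 1) / 4) ∧ 2 ≤ k ∧ k ≤ p - 2 ∧ χ (-1) * (-1) ^ k = -1 ∧
      (∀ ℓ : ℕ, ℓ.Prime → ℓ ≠ p →
        ((W.LFunction ℓ : ℤ) : ZMod p) = (ε ℓ : ZMod p) * ((ℓ : ZMod p) ^ k + (ℓ : ZMod p) ^ (p - k))) ∧
      (∀ ℓ : ℕ, (hℓ : ℓ.Prime) → ℓ ≠ p → ¬ ℓ ∣ m → (haveI := Fact.mk hℓ; W.HasGoodReductionAtPrime ℓ)) := by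
  have hpp : p.Prime := hp.out
  have hp2 : p ≠ 2 := by omega
  have hp7 : 7 ≤ p := by omega
  obtain ⟨W', hW'E, hiso', hj⟩ := hW
  -- a twisting parameter coprime to `p`, up to isogeny
  obtain ⟨e, he0, hsq, hpe, W₁, hW₁E, _, C, hC, hiso₁⟩ :=
    RelativeAnchorTransfer.exists_coprime_twist_isIsogenous (W := W') hCME hramE h5 hj
  have hiso : IsIsogenous W W₁ := hiso'.trans' hiso₁
  obtain ⟨m, hm, χ, ε, hmp, hχ, hχq, hε, hsign, htr, hgoodW⟩ :=
    exists_krizLiData_of_coprime_twist hp2 E ((p + 1) / 4) ((3 * p - 1) / 4) hgood hbase W W₁ hiso hsq hpe ⟨C, hC⟩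
  -- the odd exponent
  have hsum : _root_.Odd ((p + 1) / 4 + (3 * p - 1) / 4) := by
    have e1 : (p + 1) / 4 + (3 * p - 1) / 4 = p := by omega
    rw [e1]; exact hpp.odd_of_ne_two hp2
  obtain ⟨k, hk, hodd⟩ := exists_exponent_odd hsign hsum
  refine ⟨m, hm, χ, ε, k, hmp, hχ, hχq, hε, hk, ?_, ?_, hodd, ?_, hgoodW⟩
  · rcases hk with rfl | rfl <;> omega
  · rcases hk with rfl | rfl <;> omega
  · intro ℓ hℓ hne
    rw [htr ℓ hℓ hne]
    rcases hk with rfl | rfl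
    · have e2 : p - (p + 1) / 4 = (3 * p - 1) / 4 := by omega
      rw [e2]
    · have e2 : p - (3 * p - 1) / 4 = (p + 1) / 4 := by omega
      rw [e2, add_comm]

/-! ## §2 The six base curves: CM, CM-ramified -/

/-- The base curves `A(p)` have CM (their `j` lies in the maximal-order table). [cite: SilvermanATAEC1994, App. A §3] -/
theorem hasCM_bases :
    cm7.HasCM ∧ cm11.HasCM ∧ cm19.HasCM ∧ cm43.HasCM ∧ cm67.HasCM ∧ cm163.HasCM := by
  refine ⟨?_, ?_, ?_, ?_, ?_, ?_⟩ <;>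
    refine hasCM_of_j_mem_maximalCMJInvariants_holds _ ?_ <;>
    simp [j_cm7, j_cm11, j_cm19, j_cm43, j_cm67, j_cm163, maximalCMJInvariants]

/-- The base curves `A(p)` are CM-ramified at `p` (`p ∣ d_K = −p`). [cite: SilvermanATAEC1994, App. A §3] -/
theorem cmRamified_bases :
    CMRamified cm7 7 ∧ CMRamified cm11 11 ∧ CMRamified cm19 19 ∧ CMRamified cm43 43 ∧ CMRamified cm67 67 ∧
      CMRamified cm163 163 := by
  refine ⟨?_, ?_, ?_, ?_, ?_, ?_⟩ <;>
    simp only [CMRamified, j_cm7, j_cm11, j_cm19, j_cm43, j_cm67, j_cm163, cmFieldDiscrOfJ] <;> norm_num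

/-! ## §3 CLASS-WIDE: the character data on the crux's binders -/

/-- **The character data exist on the whole class.** For every elliptic `W/ℚ` with CM and every prime `p ≥ 5` ramified in the
CM field (`CMRamified W p`; the seven leaf classes at `p ∈ {7, 11, 19, 43, 67, 163}`): there are `m` coprime to `p`, a primitive
quadratic `ℚ_p`-valued `χ` mod `m` with integer values `ε`, and `k ∈ {(p+1)/4, (3p−1)/4}` (`2 ≤ k ≤ p−2`, `χ(−1)(−1)^k = −1`) with
the trace form `a_ℓ(W) ≡ ε(ℓ)(ℓ^k + ℓ^{p−k}) (mod p)` at EVERY prime `ℓ ≠ p` and `W` good at every prime `ℓ ≠ p`, `ℓ ∤ m`.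
[cite: Mazur1978, Prop. 6.3 (1) (p. 153)] [cite: BuhlerGross1985, Ch. I (4.3) (p. 14)] [cite: SilvermanAEC2009, X.5 Prop. 5.4 and Cor. 5.4.1] -/
theorem exists_krizLiData_of_cmRamified (W : WeierstrassCurve ℚ) [W.IsElliptic] (hCM : W.HasCM) (hram : CMRamified W p)
    (h5 : 5 ≤ p) :
    ∃ (m : ℕ) (_ : NeZero m) (χ : DirichletCharacter ℚ_[p] m) (ε : ℕ → ℤ) (k : ℕ),
      m.Coprime p ∧ χ.IsPrimitive ∧ χ.IsQuadratic ∧ (∀ a : ℕ, χ (a : ZMod m) = (ε a : ℚ_[p])) ∧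
      (k = (p + 1) / 4 ∨ k = (3 * p - 1) / 4) ∧ 2 ≤ k ∧ k ≤ p - 2 ∧ χ (-1) * (-1) ^ k = -1 ∧
      (∀ ℓ : ℕ, ℓ.Prime → ℓ ≠ p →
        ((W.LFunction ℓ : ℤ) : ZMod p) = (ε ℓ : ZMod p) * ((ℓ : ZMod p) ^ k + (ℓ : ZMod p) ^ (p - k))) ∧
      (∀ ℓ : ℕ, (hℓ : ℓ.Prime) → ℓ ≠ p → ¬ ℓ ∣ m → (haveI := Fact.mk hℓ; W.HasGoodReductionAtPrime ℓ)) := by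
  obtain ⟨hCM7, hCM11, hCM19, hCM43, hCM67, hCM163⟩ := hasCM_bases
  obtain ⟨hr7, hr11, hr19, hr43, hr67, hr163⟩ := cmRamified_bases
  rcases AnchorReduction.classes_of_cmRamified W hp.out hCM hram h5 with
    ⟨rfl, hj | hj⟩ | ⟨rfl, hj⟩ | ⟨rfl, hj⟩ | ⟨rfl, hj⟩ | ⟨rfl, hj⟩ | ⟨rfl, hj⟩
  · -- `(7, −3375)`
    exact exists_krizLiData_of_base (by norm_num) h5 cm7 hCM7 hr7 (fun q _ h => RouteU.hasGoodReductionAtPrime_cm7 q h)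
      (fun ℓ _ h => by simpa using RouteU.lFunction_cm7_mod_seven ℓ h) W ⟨W, inferInstance, isIsogenous_self W, by rw [hj, j_cm7]⟩
  · -- `(7, 16581375)`: `ℚ`-isogenous to the class `j = −3375`
    obtain ⟨W', hW'E, hiso, -, hj'⟩ := exists_isIsogenous_LFunction_eq_cm28 W hj
    exact exists_krizLiData_of_base (by norm_num) h5 cm7 hCM7 hr7 (fun q _ h => RouteU.hasGoodReductionAtPrime_cm7 q h)
      (fun ℓ _ h => by simpa using RouteU.lFunction_cm7_mod_seven ℓ h) W ⟨W', hW'E, hiso, by rw [hj', j_cm7]⟩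
  · -- `(11, −32768)`
    exact exists_krizLiData_of_base (by norm_num) h5 cm11 hCM11 hr11 (fun q _ h => EisensteinTraceForm.hasGoodReductionAtPrime_cm11 q h)
      (fun ℓ _ h => by simpa using EisensteinTraceForm.lFunction_cm11_mod ℓ h) W
      ⟨W, inferInstance, isIsogenous_self W, by rw [hj, j_cm11]⟩
  · -- `(19, −884736)`
    exact exists_krizLiData_of_base (by norm_num) h5 cm19 hCM19 hr19 (fun q _ h => EisensteinTraceForm.hasGoodReductionAtPrime_cm19 q h)
      (fun ℓ _ h => by simpa using EisensteinTraceForm.lFunction_cm19_mod ℓ h) W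
      ⟨W, inferInstance, isIsogenous_self W, by rw [hj, j_cm19]⟩
  · -- `(43, −884736000)`
    exact exists_krizLiData_of_base (by norm_num) h5 cm43 hCM43 hr43 (fun q _ h => EisensteinTraceForm.hasGoodReductionAtPrime_cm43 q h)
      (fun ℓ _ h => by simpa using EisensteinTraceForm.lFunction_cm43_mod ℓ h) W
      ⟨W, inferInstance, isIsogenous_self W, by rw [hj, j_cm43]⟩
  · -- `(67, −147197952000)`
    exact exists_krizLiData_of_base (by norm_num) h5 cm67 hCM67 hr67 (fun q _ h => EisensteinTraceForm.hasGoodReductionAtPrime_cm67 q h)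
      (fun ℓ _ h => by simpa using EisensteinTraceForm.lFunction_cm67_mod ℓ h) W
      ⟨W, inferInstance, isIsogenous_self W, by rw [hj, j_cm67]⟩
  · -- `(163, −262537412640768000)`
    exact exists_krizLiData_of_base (by norm_num) h5 cm163 hCM163 hr163
      (fun q _ h => AnchorReduction.hasGoodReductionAtPrime_cm163 q h)
      (fun ℓ _ h => by simpa using AnchorReduction.lFunction_cm163_mod ℓ h) W
      ⟨W, inferInstance, isIsogenous_self W, by rw [hj, j_cm163]⟩

/-! ## §4 THE KRIZ–LI BINDERS ON THE CLASS (the packaged block of the v6 «Kriz–Li datum») -/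

/-- **KRIZ–LI BINDERS, CLASS-WIDE, FOR EVERY TEICHMÜLLER `ω`.** For every elliptic `W/ℚ` with CM, every prime `p ≥ 5` ramified
in the CM field and every Teichmüller character `ω` mod `p`: there are `f` and a `ℚ_p`-valued Dirichlet character `ψ` mod `f`
which is PRIMITIVE and ODD and satisfies — VERBATIM as `KrizLi2019.thm120_padicLogHeegner_unit_of_bernoulli` and the v6 Kriz–Li
datum bind them — the trace form `hss` (`∀ ℓ ∤ p·N_W, ‖a_ℓ(W) − (ψ(ℓ) + ψ⁻¹(ℓ)ω(ℓ))‖_p < 1`), hypothesis (1)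
(`ψ(p) ≠ 1 ∧ (ψ⁻¹ω)(p) ≠ 1`) and hypothesis (3) (at every additive `ℓ ≠ p`: `ψ(ℓ) ≠ 1 ∧ (ψ⁻¹ω)(ℓ) ≠ 1`). (`f = p·m`,
`ψ = χ·ω^k` from `exists_krizLiData_of_cmRamified` through part T's engine.) Kriz–Li's hypothesis (2) is vacuous for CM curves
(no multiplicative prime) and is discharged where the fact is applied (LEAD g5 `…RegularLocusBSDp`).
[cite: KrizLi2019, Thm. 1.20 (pp. 7–8), Rem. 1.21 (p. 8), §2 (pp. 11–12), §7.1 (p. 43)] [cite: Mazur1978, Prop. 6.3 (1) (p. 153)] -/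
theorem krizLiBinders_of_cmRamified (W : WeierstrassCurve ℚ) [W.IsElliptic] (hCM : W.HasCM) (hram : CMRamified W p)
    (h5 : 5 ≤ p) (ω : DirichletCharacter ℚ_[p] p) (hω : IsTeichmullerCharacter ω) :
    ∃ (f : ℕ) (_ : NeZero f) (ψ : DirichletCharacter ℚ_[p] f),
      ψ.IsPrimitive ∧ ψ.Odd ∧
      (∀ ℓ : ℕ, ℓ.Prime → ¬ (ℓ ∣ p * W.conductorNorm ℤ) →
        ‖((W.LFunction ℓ : ℤ) : ℚ_[p]) - (ψ (ℓ : ZMod f) + ψ⁻¹ (ℓ : ZMod f) * ω (ℓ : ZMod p))‖ < 1) ∧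
      (ψ (p : ZMod f) ≠ 1 ∧ primVal (invMulOmega ψ ω) p ≠ 1) ∧
      (∀ ℓ : ℕ, (hℓ : ℓ.Prime) → ℓ ≠ p →
        (haveI := Fact.mk hℓ; ¬ W.HasGoodReductionAtPrime ℓ ∧ ¬ W.HasMultiplicativeReductionAtPrime ℓ) →
        ψ (ℓ : ZMod f) ≠ 1 ∧ primVal (invMulOmega ψ ω) ℓ ≠ 1) := by
  have hp2 : p ≠ 2 := by have := hp.out.two_le; omega
  obtain ⟨m, hm, χ, ε, k, hmp, hχ, hχq, hε, -, hk2, hkp, hodd, htr, hgoodW⟩ :=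
    exists_krizLiData_of_cmRamified W hCM hram h5
  haveI := hm
  haveI : NeZero (p * m) := ⟨Nat.mul_ne_zero hp.out.ne_zero hm.out⟩
  obtain ⟨hprim, hss, h1, h3⟩ := krizLiBinders_of_data hp2 W χ hχ hχq hmp ε (fun ℓ _ _ => hε ℓ) hk2 hkp htr hgoodW ω hω
  exact ⟨p * m, inferInstance, _, hprim, psi_odd_of ω χ k hp2 hω (by omega) hodd, hss, h1, h3⟩

/-- **KRIZ–LI BINDERS, CLASS-WIDE (with the Teichmüller character).** Same as `krizLiBinders_of_cmRamified`, with `ω` produced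
by `KrizLi2019.exists_isTeichmullerCharacter`: the complete character block `(f, ψ, ω)` of the v6 Kriz–Li datum —
`ψ.IsPrimitive ∧ IsTeichmullerCharacter ω ∧ hss ∧ (1) ∧ (3)` — plus `ψ.Odd`, on the crux's binders.
[cite: KrizLi2019, Thm. 1.20 (pp. 7–8), Rem. 1.21, §2] [cite: Washington1997, §5.1] -/
theorem exists_krizLiBinders_of_cmRamified (W : WeierstrassCurve ℚ) [W.IsElliptic] (hCM : W.HasCM)
    (hram : CMRamified W p) (h5 : 5 ≤ p) :
    ∃ (f : ℕ) (_ : NeZero f) (ψ : DirichletCharacter ℚ_[p] f) (ω : DirichletCharacter ℚ_[p] p),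
      ψ.IsPrimitive ∧ IsTeichmullerCharacter ω ∧
      (∀ ℓ : ℕ, ℓ.Prime → ¬ (ℓ ∣ p * W.conductorNorm ℤ) →
        ‖((W.LFunction ℓ : ℤ) : ℚ_[p]) - (ψ (ℓ : ZMod f) + ψ⁻¹ (ℓ : ZMod f) * ω (ℓ : ZMod p))‖ < 1) ∧
      (ψ (p : ZMod f) ≠ 1 ∧ primVal (invMulOmega ψ ω) p ≠ 1) ∧
      (∀ ℓ : ℕ, (hℓ : ℓ.Prime) → ℓ ≠ p →
        (haveI := Fact.mk hℓ; ¬ W.HasGoodReductionAtPrime ℓ ∧ ¬ W.HasMultiplicativeReductionAtPrime ℓ) →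
        ψ (ℓ : ZMod f) ≠ 1 ∧ primVal (invMulOmega ψ ω) ℓ ≠ 1) ∧
      ψ.Odd := by
  obtain ⟨ω, hω⟩ := exists_isTeichmullerCharacter (p := p)
  obtain ⟨f, hf, ψ, hprim, hodd, hss, h1, h3⟩ := krizLiBinders_of_cmRamified W hCM hram h5 ω hω
  exact ⟨f, hf, ψ, ω, hprim, hω, hss, h1, h3, hodd⟩

end Summit.BirchSwinnertonDyer.BirchSwinnertonDyer.Theorems.PrintCFram.KrizLiBinders

end
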